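import Summits.RiemannHypothesis.RiemannHypothesis.Theorems.WeilTwoPrimeDeflC83XBase
import Summits.RiemannHypothesis.RiemannHypothesis.Theorems.WeilTwoPrimeDeflC83XDataR
import Literature.NumberTheory.LFunctions.WeilTwoPrimeCellsT120
import Summits.RiemannHypothesis.RiemannHypothesis.Theorems.GroundBartaEvenWinsBeyondArchPhantomCertificateDeflated
import Summits.RiemannHypothesis.RiemannHypothesis.Theorems.GroundBartaEvenWinsBeyondArchPhantomXT120Cells
import HarnessLib

/-!
# Deflated PHANTOM two-prime certificate C83X: the certificate `weilCertDeflC83X : WeilCert23X` and its augmented coefficient matrix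

`weilCertDeflC83X` = base `weilCertDeflC83XBase` (low level `wL₀ = weilTwoPrimeCellsT120Level`) + `j = 5` + `pnu = 64` + the cells `weilTwoPrimeCellsT120` + support `b = 83/100` + the table `weilCertDeflC83XNu` + boosted level `wL = 269/100` + phantom chain `xt120Cells` + ripples `xt120Rs`; penalty data `weilCertDeflC83XR`; `weilCertDeflC83XP = P_r + Σ μ ĉ ĉᵀ`. [cite: Yoshida1992, §6, Thm 1 p. 310] Data only.
-/

set_option linter.dupNamespace false

noncomputable section

namespace Summit.RiemannHypothesis.RiemannHypothesis.Theorems.EvenWinsBeyondArch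

open Literature.NumberTheory.LFunctions

/-- **The deflated phantom two-prime certificate C83X** (`a₀ = b = 83/100`, `N = 271`, `T = 120`, `wL = 269/100`, `β₂₃ = 13/10`, k_even = 9, k_odd = 8). [folklore] -/
def weilCertDeflC83X : WeilCert23X := ⟨weilCertDeflC83XBase, 5, 64, weilTwoPrimeCellsT120, 83/100, weilCertDeflC83XNu, 269/100, xt120Cells, xt120Rs⟩

/-- The base of `weilCertDeflC83X` is `weilCertDeflC83XBase` (definitional). [folklore] -/
theorem weilCertDeflC83X_base : weilCertDeflC83X.base = weilCertDeflC83XBase := rfl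

/-- The table of `weilCertDeflC83X` is `weilCertDeflC83XNu` (definitional). [folklore] -/
theorem weilCertDeflC83X_nuTab : weilCertDeflC83X.nuTab = weilCertDeflC83XNu := rfl

/-- The augmented coefficient matrix `P_r + Σ μ ĉ ĉᵀ` of certificate C83X. [folklore] -/
def weilCertDeflC83XP (k l : ℕ) : ℚ := weilCertDeflC83XBase.prQ weilCertDeflC83XNu k l + rankOneQ weilCertDeflC83XR k l

/-- `weilCertDeflC83XP` is the augmented matrix of the certificate (definitional). [folklore] -/
theorem weilCertDeflC83XP_eq : weilCertDeflC83XP = fun k l ↦ weilCertDeflC83X.base.prQ weilCertDeflC83X.nuTab k l + rankOneQ weilCertDeflC83XR k l := rfl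

end Summit.RiemannHypothesis.RiemannHypothesis.Theorems.EvenWinsBeyondArch
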